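import Literature.IUT.HodgeArakelov.LabelClassesOfCuspsRmk231Genuine
import HarnessLib

/-!
# [IUTchII] Def 2.3 (ii) AT THE GENUINE TOWER: the statement of record `Def23_ii'` for `(Π_v, Π^±_v)` and the cusp datum of record, from
# ONE instance of [CombGC] Prop 1.2 (ii) (commensurable terminality of the cuspidal inertia groups; FACT-LIST F-0438)

S. Mochizuki, *Inter-universal Teichmüller Theory II*, kurims manuscript (Dec. 2020), §2, Def 2.3 (ii) p. 68: «the cuspidal inertia groups of
`Π_⊆` may be obtained as the intersections with `Π_⊆` of those cuspidal inertia groups of `Π_⊇` that contain a finite index subgroup that lies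
inside `Π_⊆` [cf. [IUTchI], Corollary 2.5; [IUTchI], Remark 2.5.2], while the cuspidal inertia groups of `Π_⊇` may be obtained as the
`Π_⊇`-conjugates of the commensurators [or, alternatively, the normalizers] in `Π_⊇` of the cuspidal inertia groups of `Π_⊆` [cf. [CombGC],
Proposition 1.2, (ii)]» ([IUTchII] Def 2.3 (ii), kurims p.68) [cite: Mochizuki2012, II Def 2.3 (ii) p.68]; [CombGC] Prop 1.2 (ii) p. 8
(verticial and edge-like subgroups of a PSC-type fundamental group are commensurably terminal) [cite: MochizukiCombGC2007, Prop 1.2(ii) p.8].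
abc-iut cell, node **IUTchII:Def2.3(ii)** (zone [IUTchII] §2; seat abc-iut-L6-t19 gen 6; row «DEF23ii-COMM» of abc-iut-L6-lead §F v1.19ar).
PROOF-ONLY (no `def`), sequel of `LabelClassesOfCuspsRmk231Genuine.lean` (p444107).

THE POINT.  The statement of record of the node is abc-iut-L6-t19's REPAIRED predicate `Def23_ii' Cu Π_⊆ Π_⊇` (p408509; three conjuncts:
`Π_⊆ ≤ Π_⊇`; «intersections with `Π_⊆`» with the finite-index clause; «`Π_⊇`-conjugates of the normalisers IN `Δ_⊇ := Π_⊇ ∩ Δ̂^cor_v`» — the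
normaliser taken in the geometric group as [CombGC] Prop 1.2 (ii) requires).  For the pair `(Π_v, Π^±_v)` of ANY tower over the print-level
model and the cusp datum `Cu` of an agreement with abc-iut-L5's datum of `X̲_v` (abc-iut-w5-d132's p434636 at the tower of record), conjuncts 1–2
are kernel facts (the levels clause + `finiteIndex_inf_of_inputs` p417290, whose inputs are now theorems: normality p429966, index p429377,
total ramification p444107), and conjunct 3 follows from ONE input — [CombGC] Prop 1.2 (ii) AT THE INSTANCE: every `Π^±_v`-cuspidal inertia
group `I′` is commensurably terminal in `Δ^±_v = Π^±_v ∩ Δ̂^cor_v` (FACT-LIST **F-0438** `CommensurableTerminalityHolds`, admissible at named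
instances; here in abc-iut-L4's vocabulary `IsCommensurablyTerminal`, hypothesis `hCT`) — because then `N_{Δ^±_v}(I′ ∩ Π_v) = N_{Δ^±_v}(I′^l) = I′`
(`I′ ∩ Π_v = I′^l` of finite index `l`, Rmk 2.3.1 / p444107: the normaliser lies in the commensurator of `I′^l` = commensurator of `I′` = `I′`).

* `map_normalizer_subgroupOf_eq_of_commTerminal` — group theory: `I′ ≤ Δ`, `J ≤ I′` of finite index, `I′` normalises `J`, `I′` commensurably
  terminal in `Δ` ⇒ the normaliser of `J` in `Δ` is `I′`;
* `StableCurveAgreement.le_deltaCorHat_of_isCuspidalInertia_piPM` — `Π^±_v`-cuspidal groups are geometric (`≤ Δ̂^cor_v`);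
* `StableCurveAgreement.isCuspidalInertia_piPM_conj` — the `Π^±_v`-family is stable under `Π^±_v`-conjugation (abc-iut-L6-t7's `map_subgroupOf_conj`);
* **`StableCurveAgreement.def23_ii'_genuine`** — `Def23_ii' Cu W.piV W.piPM`, granted `hCT` (+ the inputs of p444107: (C3), `l·Δ_Θ ≠ Δ_Θ`, hN);
* **`def23_ii'_ofPiCHat`** — the package at the tower of record: `∃ Cu A`, the p434636 clauses, `Rmk231_powers …`, and `hCT → Def23_ii' Cu Π_v Π^±_v`.

HONEST LABEL: the [CombGC] Prop 1.2 (ii) instance `hCT` is a HYPOTHESIS (F-0438 at the named instance), not proved; the other binders are those of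
p444107.  Nothing of the series is asserted; no side taken on [IUTchIII] Cor 3.12.
-/

noncomputable section

namespace Literature.IUT.HodgeArakelov

open Literature.AnabelianGeometry.EtaleTheta Literature.AnabelianGeometry.SemiGraphs Literature.IUT.HodgeTheaters
open Literature.AnabelianGeometry.AbsoluteAnabelian (IsCommensurablyTerminal)
open scoped Pointwise

namespace PlusMinusTower

/-! ## Group theory -/

section GroupTheory

variable {G : Type*} [Group G]

/-- The normaliser is contained in the commensurator. [folklore] -/
private theorem normalizer_le_commensurator' (K : Subgroup G) :
    Subgroup.normalizer (K : Set G) ≤ Subgroup.Commensurable.commensurator K := by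
  intro g hg
  have hg' := Subgroup.mem_normalizer_iff''.mp hg
  rw [Subgroup.Commensurable.commensurator_mem_iff]
  have : ConjAct.toConjAct g • K = K := by
    ext x
    rw [Subgroup.mem_pointwise_smul_iff_inv_smul_mem, ← map_inv, ConjAct.smul_def,
      ConjAct.ofConjAct_toConjAct, inv_inv, ← hg' x]
  rw [this]

/-- **[CombGC] Prop 1.2 (ii) ⇒ normalisers of finite-index subgroups** (kurims p. 8; the group theory behind [IUTchII] Def 2.3 (ii) conj. 3):
if `I′ ≤ Δ` is commensurably terminal in `Δ` and `J ≤ I′` has finite index and is normalised by `I′`, then the normaliser of `J` in `Δ` is `I′`.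
PROVED. [cite: MochizukiCombGC2007, Prop 1.2(ii) p.8] -/
theorem map_normalizer_subgroupOf_eq_of_commTerminal {Δ I' J : Subgroup G} (hI'Δ : I' ≤ Δ) (hJI' : J ≤ I')
    (hfin : (J.subgroupOf I').FiniteIndex) (hnorm : I' ≤ Subgroup.normalizer (J : Set G))
    (hCT : IsCommensurablyTerminal (I'.subgroupOf Δ)) :
    (Subgroup.normalizer ((J.subgroupOf Δ : Subgroup Δ) : Set Δ)).map Δ.subtype = I' := by
  apply le_antisymm
  · rintro _ ⟨n, hn, rfl⟩
    -- `n` commensurates `J`, hence `I'` (commensurable with `J`), hence lies in `I'`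
    have h1 : n ∈ Subgroup.Commensurable.commensurator (J.subgroupOf Δ) := normalizer_le_commensurator' _ hn
    have hcomm : Subgroup.Commensurable (J.subgroupOf Δ) (I'.subgroupOf Δ) := by
      constructor
      · rw [Subgroup.relIndex_subgroupOf hI'Δ]
        exact hfin.index_ne_zero
      · rw [Subgroup.relIndex_subgroupOf (hJI'.trans hI'Δ), Subgroup.relIndex_eq_one.mpr hJI']
        exact one_ne_zero
    rw [Subgroup.Commensurable.eq hcomm, hCT.commensurator_eq, Subgroup.mem_subgroupOf] at h1
    exact h1
  · intro x hx
    refine ⟨⟨x, hI'Δ hx⟩, ?_, rfl⟩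
    have hx' := Subgroup.mem_normalizer_iff.mp (hnorm hx)
    rw [SetLike.mem_coe, Subgroup.mem_normalizer_iff]
    intro h
    rw [Subgroup.mem_subgroupOf, Subgroup.mem_subgroupOf]
    exact hx' h

/-- Stability of the normaliser condition: if `J = I' ⊓ V` with `V` normalised by every element of `I'`, then `I'` normalises `J`. [folklore] -/
private theorem le_normalizer_inf_of_conj_mem {I' V : Subgroup G} (hV : ∀ x ∈ I', ∀ v, v ∈ V ↔ x * v * x⁻¹ ∈ V) :
    I' ≤ Subgroup.normalizer ((I' ⊓ V : Subgroup G) : Set G) := by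
  intro x hx
  rw [Subgroup.mem_normalizer_iff]
  intro h
  rw [Subgroup.mem_inf, Subgroup.mem_inf]
  constructor
  · rintro ⟨h1, h2⟩
    exact ⟨I'.mul_mem (I'.mul_mem hx h1) (I'.inv_mem hx), (hV x hx h).mp h2⟩
  · rintro ⟨h1, h2⟩
    refine ⟨?_, (hV x hx h).mpr h2⟩
    have := I'.mul_mem (I'.mul_mem (I'.inv_mem hx) h1) hx
    simpa [mul_assoc] using this

/-- Conjugation commutes with taking images: `f(a) · f(K) · f(a)⁻¹ = f(a K a⁻¹)`. [folklore] -/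
private theorem conj_smul_map {H : Type*} [Group H] (f : G →* H) (a : G) (K : Subgroup G) :
    MulAut.conj (f a) • K.map f = (MulAut.conj a • K).map f := by
  rw [← map_conj_eq_smul, ← map_conj_eq_smul, Subgroup.map_map, Subgroup.map_map]
  congr 1
  ext x
  simp [MulAut.conj_apply, map_mul, map_inv]

end GroupTheory

/-! ## At a genuine agreement over the print-level model -/

section Genuine

variable {p : ℕ} [Fact p.Prime] {M : MuTwoSetting p}
  {E : M.toThetaSetting.EtaleThetaData} {l : ℕ} (C : E.DoubleUnderline l) {N : ℕ+}
  (μ : M.toThetaSetting.CyclotomeMod l N) (hC : M.toThetaSetting.Compat) (hS : M.toThetaSetting.Sec2Hyps)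
  (hl : l.Prime) (hp2 : p ≠ 2) (hpl : p ≠ l) (hζ : ∃ ζ : M.toThetaSetting.K, IsPrimitiveRoot ζ (4 * l))
  {η : (C.thetaEnvData μ hC hS).PiYdd → MuN p N} (hη : η ∈ (C.thetaEnvData μ hC hS).thetaCocycles)
  {P : TopGroup.{0}} {T : TemperedCoverings (BadPlaceSetting.ofUnderline C μ hC hS hl hp2 hpl hζ hη) P}
  (d : M.toTemperedCurve.GroupLevelData)
  (Sfu : SpecialFibreData ((M.toThetaSetting.temperedCurveXuOfLevelData l C.l_ne_zero d).toTemperedArithmeticGroup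
    (M.toThetaSetting.groupLevelDataXu l C.l_ne_zero d)))
  (h36u : Sfu.Gc.Prop36Hypotheses) (Sigmau SigmaHatu : Set ℕ) (hsubu : Sigmau ⊆ SigmaHatu) (hneu : Sigmau.Nonempty)
  (hprimeu : ∀ q ∈ SigmaHatu, q.Prime) (hpu : p ∉ Sigmau) (TpHu : Subgroup Sfu.chart.G)
  (HatHu : Subgroup (TemperedGraphGroupData.exists_completion_of_prop36 Sfu.Gc h36u Sfu.chart).choose)
  (hleu : TpHu.map (TemperedGraphGroupData.exists_completion_of_prop36 Sfu.Gc h36u Sfu.chart).choose_spec.choose.toMonoidHom ≤ HatHu)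
  (cuspu : {x : (M.toThetaSetting.temperedCurveXuOfLevelData l C.l_ne_zero d).Pt //
    (M.toThetaSetting.temperedCurveXuOfLevelData l C.l_ne_zero d).IsCusp x} → Prop)

/-- The `Π^±_v`-cuspidal inertia groups of an agreement's cusp datum are GEOMETRIC: they lie in `Δ̂^cor_v = Ker(aug)` (their `eHat`-images are
`Π^tp`-conjugates of the `I_y ⊆ Δ^temp`, and `A.mem_ker_iff`). ([IUTchII] Def 2.3 (ii), kurims p.68) [claim: Mochizuki2012, status: disputed] -/
theorem StableCurveAgreement.le_deltaCorHat_of_isCuspidalInertia_piPM (W : PlusMinusTower T) {Cu : CuspidalInertiaData W}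
    (A : StableCurveAgreement W Cu
      (StableCurveTemperedData.ofSpecialFibre (M.toThetaSetting.temperedCurveXuOfLevelData l C.l_ne_zero d)
        (M.toThetaSetting.groupLevelDataXu l C.l_ne_zero d) Sfu h36u Sigmau SigmaHatu hsubu hneu hprimeu hpu TpHu HatHu hleu cuspu))
    {I : Subgroup W.Corhat} (hI : Cu.IsCuspidalInertia W.piPM I) : I ≤ W.piPM ⊓ W.deltaCorHat := by
  obtain ⟨hIle, xu, t, hEq⟩ := (A.inertia_iff I).mp hI
  intro y hy
  refine Subgroup.mem_inf.mpr ⟨hIle hy, ?_⟩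
  have hypm : y ∈ W.pmHat := W.emb_le_pmHat (hIle hy)
  rw [show (y ∈ W.deltaCorHat ↔ _) from A.mem_ker_iff ⟨y, hypm⟩]
  have h1 : A.eHat ⟨y, hypm⟩ ∈ (I.subgroupOf W.pmHat).map A.eHat.toMonoidHom :=
    ⟨⟨y, hypm⟩, Subgroup.mem_subgroupOf.mpr hy, rfl⟩
  rw [hEq] at h1
  obtain ⟨k, hk, hky⟩ := h1
  rw [← hky, MonoidHom.mem_ker, ← MonoidHom.comp_apply, StableCurveTemperedData.prHat_comp]
  -- `k = t u t⁻¹` with `u ∈ Δ^tp`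
  rw [SetLike.mem_coe, Subgroup.mem_pointwise_smul_iff_inv_smul_mem] at hk
  obtain ⟨u, -, hu⟩ := hk
  have hk' : k = t * (u : _) * t⁻¹ := by
    have : (u : _) = (MulAut.conj t)⁻¹ • k := hu
    rw [MulAut.smul_def, MulAut.conj_inv_apply] at this
    rw [this]; group
  rw [hk', map_mul, map_mul, map_inv, MonoidHom.mem_ker.mp u.2, mul_one, mul_inv_cancel]

/-- The `Π^±_v`-family of an agreement's cusp datum is STABLE under `Π^±_v`-conjugation: `I′ ↦ g I′ g⁻¹` for `g = emb w ∈ Π^±_v` replaces the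
parameter `t ∈ Π^tp_{X̲_v}` by `plainIso(w) · t` (abc-iut-L6-t7's `map_subgroupOf_conj` + `A.eHat ∘ emb = toHat ∘ plainIso`).
([IUTchII] Def 2.3 (ii), kurims p.68) [claim: Mochizuki2012, status: disputed] -/
theorem StableCurveAgreement.isCuspidalInertia_piPM_conj (W : PlusMinusTower T) {Cu : CuspidalInertiaData W}
    (A : StableCurveAgreement W Cu
      (StableCurveTemperedData.ofSpecialFibre (M.toThetaSetting.temperedCurveXuOfLevelData l C.l_ne_zero d)
        (M.toThetaSetting.groupLevelDataXu l C.l_ne_zero d) Sfu h36u Sigmau SigmaHatu hsubu hneu hprimeu hpu TpHu HatHu hleu cuspu))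
    (hA : ∀ x : T.Xplain, A.eHat ⟨W.emb x, W.emb_le_pmHat ⟨x, rfl⟩⟩ =
      (StableCurveTemperedData.ofSpecialFibre (M.toThetaSetting.temperedCurveXuOfLevelData l C.l_ne_zero d)
        (M.toThetaSetting.groupLevelDataXu l C.l_ne_zero d) Sfu h36u Sigmau SigmaHatu hsubu hneu hprimeu hpu TpHu HatHu hleu cuspu).ιX
        (T.plainIso x))
    {I : Subgroup W.Corhat} (hI : Cu.IsCuspidalInertia W.piPM I) {g : W.Corhat} (hg : g ∈ W.piPM) :
    Cu.IsCuspidalInertia W.piPM (I.map (MulAut.conj g).toMonoidHom) := by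
  obtain ⟨hIle, xu, t, hEq⟩ := (A.inertia_iff I).mp hI
  obtain ⟨w, rfl⟩ := hg
  have hgpm : W.emb w ∈ W.pmHat := W.emb_le_pmHat ⟨w, rfl⟩
  refine (A.inertia_iff _).mpr ⟨?_, xu, ⟨(T.plainIso w).1, (T.plainIso w).2⟩ * t, ?_⟩
  · rintro _ ⟨y, hy, rfl⟩
    exact W.piPM.mul_mem (W.piPM.mul_mem ⟨w, rfl⟩ (hIle hy)) (W.piPM.inv_mem ⟨w, rfl⟩)
  · rw [map_conj_eq_smul, map_subgroupOf_conj A.eHat I hgpm, hEq, hA w, map_mul, mul_smul]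
    -- `conj (ιX k) • (K.map ιX) = (conj k • K).map ιX`
    exact conj_smul_map _ _ _

variable
  -- the [EtTh] cusp clause of the base curve `X_v` and the non-degeneracy (as for p444107)
  (hC3 : ∀ x : M.toTemperedCurve.Pt, M.toTemperedCurve.IsCusp x →
    (M.toTemperedCurve.inertia x).map M.toThetaSetting.toTheta = M.toThetaSetting.DeltaTheta)
  (hproper : M.toThetaSetting.lDeltaTheta l ≠ M.toThetaSetting.DeltaTheta)

include hC3 hproper in
/-- **[IUTchII] Def 2.3 (ii) — the statement of record `Def23_ii'` for `(Π_v, Π^±_v)` AT A GENUINE AGREEMENT**, for ANY tower `W` over a Prop 2.1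
output of `BadPlaceSetting.ofUnderline` with `Π̂^cor_v` Hausdorff and `emb` continuous, ANY cusp datum `Cu` with an agreement `A` with the [IUTchI]
§2 datum of `X̲_v` (clause `A.eHat ∘ emb = toHat ∘ plainIso`, levels by intersection), GRANTED [CombGC] Prop 1.2 (ii) AT THE INSTANCE (`hCT`: every
`Π^±_v`-cuspidal inertia group is commensurably terminal in `Δ^±_v = Π^±_v ∩ Δ̂^cor_v`; FACT-LIST F-0438), the cusp clause (C3) and
`l·Δ_Θ ≠ Δ_Θ` of p444107, and hN: (1) `Π_v ≤ Π^±_v`; (2) «intersections with `Π_v`, with the finite-index clause» (levels +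
`finiteIndex_inf_of_inputs`); (3) «`Π^±_v`-conjugates of the normalisers in `Δ^±_v`»: `N_{Δ^±_v}(I′ ∩ Π_v) = I′` (Rmk 2.3.1 `I′ ∩ Π_v = I′^l` p444107
+ `map_normalizer_subgroupOf_eq_of_commTerminal`) and the family is conjugation-stable (`isCuspidalInertia_piPM_conj`).  PROVED.
([IUTchII] Def 2.3 (ii), kurims p.68) [cite: Mochizuki2012, II Def 2.3 (ii) p.68] [cite: MochizukiCombGC2007, Prop 1.2(ii) p.8]
[claim: Mochizuki2012, status: disputed] -/
theorem StableCurveAgreement.def23_ii'_genuine (hN : (C.Huu.subgroupOf (M.GtpXu l)).Normal) (W : PlusMinusTower T)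
    [T2Space W.Corhat] (hemb : Continuous W.emb) {Cu : CuspidalInertiaData W}
    (A : StableCurveAgreement W Cu
      (StableCurveTemperedData.ofSpecialFibre (M.toThetaSetting.temperedCurveXuOfLevelData l C.l_ne_zero d)
        (M.toThetaSetting.groupLevelDataXu l C.l_ne_zero d) Sfu h36u Sigmau SigmaHatu hsubu hneu hprimeu hpu TpHu HatHu hleu cuspu))
    (hA : ∀ x : T.Xplain, A.eHat ⟨W.emb x, W.emb_le_pmHat ⟨x, rfl⟩⟩ =
      (StableCurveTemperedData.ofSpecialFibre (M.toThetaSetting.temperedCurveXuOfLevelData l C.l_ne_zero d)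
        (M.toThetaSetting.groupLevelDataXu l C.l_ne_zero d) Sfu h36u Sigmau SigmaHatu hsubu hneu hprimeu hpu TpHu HatHu hleu cuspu).ιX
        (T.plainIso x))
    (hlev : ∀ (Q I : Subgroup W.Corhat), Cu.IsCuspidalInertia Q I ↔
      I ≤ Q ∧ ∃ I₀ : Subgroup W.Corhat, Cu.IsCuspidalInertia W.piPM I₀ ∧ I = I₀ ⊓ Q)
    (hCT : ∀ I' : Subgroup W.Corhat, Cu.IsCuspidalInertia W.piPM I' →
      IsCommensurablyTerminal (I'.subgroupOf (W.piPM ⊓ W.deltaCorHat))) :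
    Literature.IUT.HodgeArakelov.Def23_ii' Cu W.piV W.piPM := by
  -- the inputs of Rmk 2.3.1 at the genuine agreement (p429966, p429377, p444107)
  have hN' : (W.piV.subgroupOf W.piPM).Normal := W.piV_subgroupOf_piPM_normal_ofUnderline C μ hC hS hl hp2 hpl hζ hη hN
  have hidx : W.piV.relIndex W.piPM = (BadPlaceSetting.ofUnderline C μ hC hS hl hp2 hpl hζ hη).l :=
    W.index_piV_subgroupOf_piPM_ofUnderline_eq_l C μ hC hS hl hp2 hpl hζ hη
  have hram : ∀ I, Cu.IsCuspidalInertia W.piPM I → ¬ I ≤ W.piV := fun _ hI =>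
    StableCurveAgreement.not_le_piV_of_isCuspidalInertia_piPM C μ hC hS hl hp2 hpl hζ hη d Sfu h36u Sigmau SigmaHatu hsubu hneu hprimeu
      hpu TpHu HatHu hleu cuspu hC3 hproper W A hA hI
  have hpow := StableCurveAgreement.rmk231_powers_genuine C μ hC hS hl hp2 hpl hζ hη d Sfu h36u Sigmau SigmaHatu hsubu hneu hprimeu hpu
    TpHu HatHu hleu cuspu hC3 hproper hN W hemb A hA
  -- `Π_v < Π^±_v` (index `l ≥ 2`)
  have hlt : W.piV < W.piPM := by
    refine lt_of_le_of_ne W.piV_le_piPM fun h => ?_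
    have h1 : W.piV.relIndex W.piPM = 1 := by rw [h, Subgroup.relIndex_self]
    rw [hidx] at h1
    exact (BadPlaceSetting.ofUnderline C μ hC hS hl hp2 hpl hζ hη).l_prime.one_lt.ne' h1
  -- the normaliser identity `N_{Δ^±_v}(I' ∩ Π_v) = I'` for every `Π^±_v`-cuspidal `I'`
  have hN_eq : ∀ I', Cu.IsCuspidalInertia W.piPM I' →
      (Subgroup.normalizer (((I' ⊓ W.piV).subgroupOf (W.piPM ⊓ W.deltaCorHat) :
        Subgroup ↥(W.piPM ⊓ W.deltaCorHat)) : Set ↥(W.piPM ⊓ W.deltaCorHat))).map (W.piPM ⊓ W.deltaCorHat).subtype = I' := by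
    intro I' hI'
    have hI'Δ := StableCurveAgreement.le_deltaCorHat_of_isCuspidalInertia_piPM C μ hC hS hl hp2 hpl hζ hη d Sfu h36u Sigmau SigmaHatu
      hsubu hneu hprimeu hpu TpHu HatHu hleu cuspu W A hI'
    refine map_normalizer_subgroupOf_eq_of_commTerminal hI'Δ inf_le_left
      (finiteIndex_inf_of_inputs Cu hN' hidx hram hI').2 ?_ (hCT I' hI')
    refine le_normalizer_inf_of_conj_mem fun x hx v => ?_
    -- `Π_v` is normalised by `Π^±_v ∋ x`
    have hxpm : x ∈ W.piPM := (Subgroup.mem_inf.mp (hI'Δ hx)).1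
    constructor
    · intro hv
      have := hN'.conj_mem ⟨v, W.piV_le_piPM hv⟩ (Subgroup.mem_subgroupOf.mpr hv) ⟨x, hxpm⟩
      exact Subgroup.mem_subgroupOf.mp this
    · intro hv
      have := hN'.conj_mem ⟨x * v * x⁻¹, W.piV_le_piPM hv⟩ (Subgroup.mem_subgroupOf.mpr hv) ⟨x, hxpm⟩⁻¹
      have h2 : ((⟨x, hxpm⟩⁻¹ * ⟨x * v * x⁻¹, W.piV_le_piPM hv⟩ * (⟨x, hxpm⟩⁻¹)⁻¹ : W.piPM) : W.Corhat) = v := by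
        push_cast
        group
      have h3 := Subgroup.mem_subgroupOf.mp this
      rw [h2] at h3
      exact h3
  refine ⟨W.piV_le_piPM, fun I => ?_, fun I' => ?_⟩
  · -- conjunct 2: intersections with `Π_v`, finite-index clause
    constructor
    · intro hI
      obtain ⟨-, I₀, hI₀, rfl⟩ := (hlev _ _).mp hI
      exact ⟨I₀, hI₀, (finiteIndex_inf_of_inputs Cu hN' hidx hram hI₀).2, rfl⟩
    · rintro ⟨I', hI', -, rfl⟩
      exact (hlev _ _).mpr ⟨inf_le_right, I', hI', rfl⟩
  · -- conjunct 3: `Π^±_v`-conjugates of the normalisers in `Δ^±_v`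
    constructor
    · intro hI'
      refine ⟨I' ⊓ W.piV, (hlev _ _).mpr ⟨inf_le_right, I', hI', rfl⟩, 1, W.piPM.one_mem, ?_⟩
      rw [hN_eq I' hI', map_one]
      exact (Subgroup.map_id I').symm
    · rintro ⟨I, hI, g, hg, rfl⟩
      obtain ⟨-, I₀, hI₀, rfl⟩ := (hlev _ _).mp hI
      rw [hN_eq I₀ hI₀]
      exact StableCurveAgreement.isCuspidalInertia_piPM_conj C μ hC hS hl hp2 hpl hζ hη d Sfu h36u Sigmau SigmaHatu hsubu hneu hprimeu
        hpu TpHu HatHu hleu cuspu W A hA hI₀ hg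

end Genuine

/-! ## The package at the tower of record -/

section Record

variable {p : ℕ} [Fact p.Prime] {M : MuTwoSetting p} (e : M.CLevelData)
  {E : M.toThetaSetting.EtaleThetaData} {l : ℕ} (C : E.DoubleUnderline l) {N : ℕ+}
  (μ : M.toThetaSetting.CyclotomeMod l N) (hC : M.toThetaSetting.Compat) (hS : M.toThetaSetting.Sec2Hyps)
  (hl : l.Prime) (hp2 : p ≠ 2) (hpl : p ≠ l) (hζ : ∃ ζ : M.toThetaSetting.K, IsPrimitiveRoot ζ (4 * l))
  {η : (C.thetaEnvData μ hC hS).PiYdd → MuN p N} (hη : η ∈ (C.thetaEnvData μ hC hS).thetaCocycles)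
  (hZ : Thm16Sub.KerToZIsCompactlyGenerated M.toThetaSetting) (hN : (C.Huu.subgroupOf (M.GtpXu l)).Normal)
  {P : TopGroup.{0}} (T : TemperedCoverings (BadPlaceSetting.ofUnderline C μ hC hS hl hp2 hpl hζ hη) P)
  (d : M.toTemperedCurve.GroupLevelData)
  (Sfu : SpecialFibreData ((M.toThetaSetting.temperedCurveXuOfLevelData l C.l_ne_zero d).toTemperedArithmeticGroup
    (M.toThetaSetting.groupLevelDataXu l C.l_ne_zero d)))
  (h36u : Sfu.Gc.Prop36Hypotheses) (Sigmau SigmaHatu : Set ℕ) (hsubu : Sigmau ⊆ SigmaHatu) (hneu : Sigmau.Nonempty)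
  (hprimeu : ∀ q ∈ SigmaHatu, q.Prime) (hpu : p ∉ Sigmau) (TpHu : Subgroup Sfu.chart.G)
  (HatHu : Subgroup (TemperedGraphGroupData.exists_completion_of_prop36 Sfu.Gc h36u Sfu.chart).choose)
  (hleu : TpHu.map (TemperedGraphGroupData.exists_completion_of_prop36 Sfu.Gc h36u Sfu.chart).choose_spec.choose.toMonoidHom ≤ HatHu)
  (cuspu : {x : (M.toThetaSetting.temperedCurveXuOfLevelData l C.l_ne_zero d).Pt //
    (M.toThetaSetting.temperedCurveXuOfLevelData l C.l_ne_zero d).IsCusp x} → Prop)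
  (hC3 : ∀ x : M.toTemperedCurve.Pt, M.toTemperedCurve.IsCusp x →
    (M.toTemperedCurve.inertia x).map M.toThetaSetting.toTheta = M.toThetaSetting.DeltaTheta)
  (hproper : M.toThetaSetting.lDeltaTheta l ≠ M.toThetaSetting.DeltaTheta)

include hC3 hproper in
/-- **[IUTchII] Def 2.3 (ii) AT THE TOWER OF RECORD `ofPiCHat`, packaged with the agreement of record** (abc-iut-w5-d132's p434636): `∃ Cu A` with
the p434636 clauses such that `Def23_ii' Cu Π_v Π^±_v` holds GRANTED [CombGC] Prop 1.2 (ii) at the instance (F-0438: commensurable terminality in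
`Δ^±_v` of the `Π^±_v`-cuspidal groups of THIS `Cu`) — plus the cusp clause (C3), `l·Δ_Θ ≠ Δ_Θ`, L02 `hZ`, `hN` and the special-fibre DATA of
`X̲_v`.  PROVED. ([IUTchII] Def 2.3 (ii), kurims p.68) [cite: Mochizuki2012, II Def 2.3 (ii) p.68] [claim: Mochizuki2012, status: disputed] -/
theorem def23_ii'_ofPiCHat :
    ∃ (Cu : CuspidalInertiaData (ofPiCHat e C μ hC hS hl hp2 hpl hζ hη hZ hN T))
      (A : StableCurveAgreement (ofPiCHat e C μ hC hS hl hp2 hpl hζ hη hZ hN T) Cu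
        (StableCurveTemperedData.ofSpecialFibre (M.toThetaSetting.temperedCurveXuOfLevelData l C.l_ne_zero d)
          (M.toThetaSetting.groupLevelDataXu l C.l_ne_zero d) Sfu h36u Sigmau SigmaHatu hsubu hneu hprimeu hpu TpHu HatHu hleu cuspu)),
      (∀ x : T.Xplain,
        A.eHat ⟨(ofPiCHat e C μ hC hS hl hp2 hpl hζ hη hZ hN T).emb x,
            (ofPiCHat e C μ hC hS hl hp2 hpl hζ hη hZ hN T).emb_le_pmHat ⟨x, rfl⟩⟩ =
          (StableCurveTemperedData.ofSpecialFibre (M.toThetaSetting.temperedCurveXuOfLevelData l C.l_ne_zero d)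
            (M.toThetaSetting.groupLevelDataXu l C.l_ne_zero d) Sfu h36u Sigmau SigmaHatu hsubu hneu hprimeu hpu TpHu HatHu hleu
            cuspu).ιX (T.plainIso x)) ∧
      (∀ (Q I : Subgroup (ofPiCHat e C μ hC hS hl hp2 hpl hζ hη hZ hN T).Corhat), Cu.IsCuspidalInertia Q I ↔
        I ≤ Q ∧ ∃ I₀, Cu.IsCuspidalInertia (ofPiCHat e C μ hC hS hl hp2 hpl hζ hη hZ hN T).piPM I₀ ∧ I = I₀ ⊓ Q) ∧
      ((∀ I' : Subgroup (ofPiCHat e C μ hC hS hl hp2 hpl hζ hη hZ hN T).Corhat,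
          Cu.IsCuspidalInertia (ofPiCHat e C μ hC hS hl hp2 hpl hζ hη hZ hN T).piPM I' →
            IsCommensurablyTerminal (I'.subgroupOf ((ofPiCHat e C μ hC hS hl hp2 hpl hζ hη hZ hN T).piPM ⊓
              (ofPiCHat e C μ hC hS hl hp2 hpl hζ hη hZ hN T).deltaCorHat))) →
        Literature.IUT.HodgeArakelov.Def23_ii' Cu (ofPiCHat e C μ hC hS hl hp2 hpl hζ hη hZ hN T).piV
          (ofPiCHat e C μ hC hS hl hp2 hpl hζ hη hZ hN T).piPM) := by
  haveI : T2Space (ofPiCHat e C μ hC hS hl hp2 hpl hζ hη hZ hN T).Corhat := e.isProfiniteCompletion_toPiCHat.t2Space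
  obtain ⟨Cu, A, hA, hlev⟩ := exists_stableCurveAgreement_ofPiCHat_ofSpecialFibreXu e C μ hC hS hl hp2 hpl hζ hη hZ hN T d Sfu h36u
    Sigmau SigmaHatu hsubu hneu hprimeu hpu TpHu HatHu hleu cuspu
  exact ⟨Cu, A, hA, hlev, fun hCT => StableCurveAgreement.def23_ii'_genuine C μ hC hS hl hp2 hpl hζ hη d Sfu h36u Sigmau SigmaHatu
    hsubu hneu hprimeu hpu TpHu HatHu hleu cuspu hC3 hproper hN (ofPiCHat e C μ hC hS hl hp2 hpl hζ hη hZ hN T)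
    (continuous_emb_ofPiCHat e C μ hC hS hl hp2 hpl hζ hη hZ hN T) A hA hlev hCT⟩

end Record

end PlusMinusTower

end Literature.IUT.HodgeArakelov

end
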